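import Summits.HubbardSuperconductivity.HubbardSuperconductivity.Theorems.AnisotropyChordThermalCondensateResponse

/-!
# Route `AnisotropyChord`, crux `ChordXY` (stmt-HubbardSuperconductivity-8146), line `thermal_af`:
# the SECOND `Δ`-derivative of the sector partition function — a Duhamel two-point function of the
# Ising part (one of the four terms of `(d/dΔ)² Λ_{β,M}`)

Notation: `P₀ = sectorProj M`, `H_M(Δ) = xxzHamiltonian 1 (torusGraph 2 M) (-1) Δ`,
`V = H_M(1) - H_M(0)` (the Ising part; `H_M(Δ) = H_M(Δ₀) + (Δ-Δ₀)V`, `xxzTorus_pencil`),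
`D(Δ) = tr(P₀ e^{-βH_M(Δ)})` the sector partition function.

By `hasDerivAt_sectorPartition_closed`, `D'(Δ) = -β·tr(P₀ e^{-βH_M(Δ)} V)` is ITSELF a sector trace
with the `Δ`-independent insertion `V`, so the first-order response theorem applies again:

* `deriv_sectorPartition_eq` — `deriv D = Δ ↦ -β·tr(P₀ e^{-βH_M(Δ)} V)`;
* **`hasDerivAt_deriv_sectorPartition`** — `D''(Δ₀) = β² ∫₀¹ tr(V P₀ e^{-sβH} V e^{-(1-s)βH}) ds`
  (`H = H_M(Δ₀)`): the Duhamel two-point function of the Ising part in the sector;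
* `deriv2_sectorPartition_eq` — the same as a formula for `deriv^[2] D Δ₀`.

This is the `D''` entry of the quotient rule for `Λ_{β,M} = N/D`
(`Λ'' = (N''D - ND'')/D² - 2D'(N'D - ND')/D³`); the `N''` entry (insertion `S⁺S⁻`, which does not
commute with `H`) needs the second Dyson term and is not constructed here. No crux closes.
Sources: Dyson–Lieb–Simon, J. Stat. Phys. 18 (1978) §3 (Duhamel two-point function as a second
derivative); Bratteli–Robinson II §5.4.1. Folklore; no definition is introduced.
-/

set_option linter.dupNamespace false

noncomputable section

open scoped Matrix.Norms.L2Operator ComplexOrder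

namespace Summit.HubbardSuperconductivity.HubbardSuperconductivity.Theorems.AnisotropyChord

open Matrix Filter Topology MeasureTheory intervalIntegral
open Literature.MathematicalPhysics.QuantumLattice Literature.Probability.LatticeModels

/-- **`deriv D = -β·tr(P₀ e^{-βH_M(·)} V)`** as functions. [folklore] -/
theorem deriv_sectorPartition_eq (M : ℕ) [NeZero M] (β : ℝ) :
    deriv (fun Δ : ℝ =>
        (sectorProj M * gibbsWeight β (xxzHamiltonian 1 (torusGraph 2 M) (-1) Δ)).trace) =
      fun Δ : ℝ => -(β : ℂ) * (sectorProj M * gibbsWeight β (xxzHamiltonian 1 (torusGraph 2 M) (-1) Δ) *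
        (xxzHamiltonian 1 (torusGraph 2 M) (-1) 1 - xxzHamiltonian 1 (torusGraph 2 M) (-1) 0)).trace := by
  funext Δ
  exact (hasDerivAt_sectorPartition_closed M β Δ).deriv

/-- **Second response of the sector partition function**: `Δ ↦ D'(Δ) = -β·tr(P₀ e^{-βH_M(Δ)} V)` is
differentiable at `Δ₀` with derivative `β² ∫₀¹ tr(V P₀ e^{-sβH} V e^{-(1-s)βH}) ds`, `H = H_M(Δ₀)` —
the Duhamel two-point function of the Ising part `V` in the sector. Dyson–Lieb–Simon (1978) §3.
[folklore] -/
theorem hasDerivAt_deriv_sectorPartition (M : ℕ) [NeZero M] (β Δ₀ : ℝ) :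
    HasDerivAt (deriv fun Δ : ℝ =>
        (sectorProj M * gibbsWeight β (xxzHamiltonian 1 (torusGraph 2 M) (-1) Δ)).trace)
      ((β : ℂ) ^ 2 * ∫ s in (0:ℝ)..1,
        ((xxzHamiltonian 1 (torusGraph 2 M) (-1) 1 - xxzHamiltonian 1 (torusGraph 2 M) (-1) 0) *
          sectorProj M * gibbsWeight (s * β) (xxzHamiltonian 1 (torusGraph 2 M) (-1) Δ₀) *
          (xxzHamiltonian 1 (torusGraph 2 M) (-1) 1 - xxzHamiltonian 1 (torusGraph 2 M) (-1) 0) *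
          gibbsWeight ((1 - s) * β) (xxzHamiltonian 1 (torusGraph 2 M) (-1) Δ₀)).trace) Δ₀ := by
  rw [deriv_sectorPartition_eq]
  have h := (hasDerivAt_sectorTrace_gibbsWeight_mul M β Δ₀
    (xxzHamiltonian 1 (torusGraph 2 M) (-1) 1 - xxzHamiltonian 1 (torusGraph 2 M) (-1) 0)).const_mul
    (-(β : ℂ))
  refine h.congr_deriv ?_
  rw [← mul_assoc]
  congr 1
  rw [sq]
  ring

/-- The same as a formula for the second iterated derivative `deriv^[2] D Δ₀`. [folklore] -/
theorem deriv2_sectorPartition_eq (M : ℕ) [NeZero M] (β Δ₀ : ℝ) :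
    deriv^[2] (fun Δ : ℝ =>
        (sectorProj M * gibbsWeight β (xxzHamiltonian 1 (torusGraph 2 M) (-1) Δ)).trace) Δ₀ =
      (β : ℂ) ^ 2 * ∫ s in (0:ℝ)..1,
        ((xxzHamiltonian 1 (torusGraph 2 M) (-1) 1 - xxzHamiltonian 1 (torusGraph 2 M) (-1) 0) *
          sectorProj M * gibbsWeight (s * β) (xxzHamiltonian 1 (torusGraph 2 M) (-1) Δ₀) *
          (xxzHamiltonian 1 (torusGraph 2 M) (-1) 1 - xxzHamiltonian 1 (torusGraph 2 M) (-1) 0) *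
          gibbsWeight ((1 - s) * β) (xxzHamiltonian 1 (torusGraph 2 M) (-1) Δ₀)).trace := by
  rw [Function.iterate_succ, Function.iterate_one, Function.comp_apply]
  exact (hasDerivAt_deriv_sectorPartition M β Δ₀).deriv

end Summit.HubbardSuperconductivity.HubbardSuperconductivity.Theorems.AnisotropyChord

end
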